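import Summits.PneNP.GCT.Max.DetKYLeadingTermsTwoIERec
import HarnessLib
import HarnessLib.Audit

/-!
# `GCT/Max`: the HISTOGRAM mirror of the leading-label count `LT2_σ(n,p,k)` — a kernel-cheap evaluation of `lt2IEFast` for whole
# columns of cells at once (cell `pub-gct-max`, track F; theory-2 memo `FINDINGS-LT2.md` §4, W2b)

`Max/DetKYLeadingTermsTwoCount.lean` / `…Fast.lean` evaluate `LT2_σ(n,p,k)` as the inclusion–exclusion triple sum
`lt2IEFast n p k σ = Σ_{I',J'} Σ_{∅≠C⊆I'×J'} (−1)^{|C|+1} C(a_C, n²−1−p)` over `Finset`s.  Two facts make that form unusable for census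
tables beyond `n = 4, k = 1`: (i) the only dependence on `p` is through the binomial, so a column of cells recomputes the same `a_C`
for every `p`; (ii) at `k = 2` the `2⁹−1` subsets `C` per `(I',J')` are enumerated through `Finset.powerset`, which the kernel cannot
evaluate at census sizes (recursion depth / budget; theory-2 gen 27 cost data).  This module proves the HISTOGRAM FORM

  `lt2IEFast n p k σ = Σ_{a ≤ n²} κ_σ(n,k)(a) · C(a, n²−1−p)`,   `κ_σ(n,k)(a) = Σ_{I',J'} Σ_{∅≠C} (−1)^{|C|+1} [a_C = a]`

(`lt2IEFast_eq_sum_histTot`), and gives a KERNEL MIRROR `totHist n k rk : List ℤ` of `κ` on a RANK FUNCTION `rk : ℕ → ℕ` of the order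
(positions and allowed-sets as bit vectors in `ℕ` — `|||`, `&&&`, `%`, `/` are GMP operations in the kernel —; the families `C` by the recursion
`ieRec` of `Max/DetKYLeadingTermsTwoIERec.lean`; rows / columns from `List.sublistsLen`; the kernel never touches the permutation `σ`), with
`vget (totHist n k rk) a = κ_σ(n,k)(a)` PROVED whenever `∀ q, (σ q : ℕ) = rk q` (`vget_totHist`).  A census module proves ONE kernel equation
`totHist n k rk = [literal]` per `(n,k,σ)` — or one literal per row `rowHist n k rk I'` when a whole histogram exceeds the per-declaration
budget (`totHist` is by definition the `foldr` of `rowHist` over `subsetsL`) — and reads every cell `(c,k)`, `c = n²−1−p`, off the literal as a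
dot product of `n²+1` integers (`le_kyRank_detPoly_of_hist`, packaged as `LT2HistogramCertificate`).  Measured: the `k = 1` histogram of `det₅`
≈ 6 s, one `k = 2` row of `det₅` (ten pairs, `5 110` families) ≈ 8 s on the farm.  First user: `Max/KYCannotSeparatePaddedPerFourFromFive.lean`.

Contents: `mkMask` (`testBit_mkMask`), the witness masks `wmask` on `rk` with `testBit_wmask` (bit `q` = the predicate of `allowedP` at the
position numbered `q`) and `card_allowedP_eq`, `pairHist` / `rowHist` / `totHist` with their meanings `histPair` / `histRow` / `histTot`, the
exchange-of-summation identity, and the certificate interface.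

HONEST FRAMING: an evaluation device for the cell's own bound `LT2` (METHOD-CEILING statements for ONE flattening family); no mathematics
beyond `Max/DetKYLeadingTermsTwoCount`; nothing here bears on dc(per_m), VP vs VNP or P vs NP. Theory-2 gen 28. [folklore]
-/

open Finset

namespace Summit.PneNP.GCT

open Literature.Computability.AlgebraicComplexity Literature.Barriers.ValiantsHypothesis

namespace DetKYLeadingTermsTwo

open DetKYLeadingTerms (vpos)

/-! ## Masks as naturals -/

/-- The mask `Σ_{q < f, Q q} 2^q`, built with `|||`. [folklore] -/
def mkMask (Q : ℕ → Bool) : ℕ → ℕ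
  | 0 => 0
  | f + 1 => mkMask Q f ||| (bif Q f then 2 ^ f else 0)

/-- Bit `i` of `mkMask Q f` is `[i < f] ∧ Q i`. [folklore] -/
theorem testBit_mkMask (Q : ℕ → Bool) (f i : ℕ) : (mkMask Q f).testBit i = (decide (i < f) && Q i) := by
  induction f with
  | zero => simp [mkMask]
  | succ f ih =>
    rw [mkMask, Nat.testBit_or, ih]
    by_cases hQ : Q f = true
    · rw [hQ, cond_true, Nat.testBit_two_pow]
      by_cases hif : i < f
      · have h1 : i < f + 1 := by omega
        have h2 : f ≠ i := by omega
        simp [hif, h1, h2]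
      · by_cases hfi : f = i
        · subst hfi; simp [hQ]
        · have h1 : ¬ i < f + 1 := by omega
          simp [hif, h1, hfi]
    · rw [Bool.not_eq_true] at hQ
      rw [hQ, cond_false, Nat.zero_testBit, Bool.or_false]
      by_cases hif : i < f
      · have h1 : i < f + 1 := by omega
        simp [hif, h1]
      · by_cases hfi : i = f
        · subst hfi; simp [hQ]
        · have h1 : ¬ i < f + 1 := by omega
          simp [hif, h1]

/-- `bitSet N (2^N − 1) = range N`. [folklore] -/
theorem bitSet_full (N : ℕ) : bitSet N (2 ^ N - 1) = range N := by
  ext i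
  simp only [bitSet, mem_filter, mem_range, Nat.testBit_two_pow_sub_one, decide_eq_true_eq, and_self]

/-- `vget` of a `foldr vadd`. [folklore] -/
theorem vget_foldr_vadd {β : Type*} (l : List β) (g : β → List ℤ) (z : List ℤ) (a : ℕ) :
    vget (l.foldr (fun b acc => vadd (g b) acc) z) a = (l.map fun b => vget (g b) a).sum + vget z a := by
  induction l with
  | nil => simp
  | cons b l ih => simp only [List.foldr_cons, vget_vadd, ih, List.map_cons, List.sum_cons]; ring

/-! ## Witness masks: the predicate of `allowedP`, read at the position numbered `q`, on a RANK FUNCTION `rk : ℕ → ℕ`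
(the kernel never evaluates the permutation `σ`; the link is the hypothesis `∀ q, (σ q : ℕ) = rk q`) -/

section Masks

variable (n : ℕ) (σ : Equiv.Perm (Fin (n * n))) (rk : ℕ → ℕ) (I' J' : Finset (Fin n))

/-- The predicate of `allowedP` for the witness `w` at the matrix position `rc`, as a Boolean. [folklore] -/
def allowedB (w rc : Fin n × Fin n) : Bool :=
  !decide (rc = w) && (!decide (σ (vpos n w) < σ (vpos n rc)) || decide (rc.1 ∈ I'.erase w.1) || decide (rc.2 ∈ J'.erase w.2))

/-- `allowedB w rc = true` iff the `allowedP` predicate holds. [folklore] -/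
theorem allowedB_eq_true_iff (w rc : Fin n × Fin n) :
    allowedB n σ I' J' w rc = true ↔ (rc ≠ w ∧ (σ (vpos n w) < σ (vpos n rc) → rc.1 ∈ I'.erase w.1 ∨ rc.2 ∈ J'.erase w.2)) := by
  simp only [allowedB, Bool.and_eq_true, Bool.or_eq_true, Bool.not_eq_true', decide_eq_true_eq, decide_eq_false_iff_not]
  tauto

/-- Membership in `allowedP C`, on the Boolean predicate. [folklore] -/
theorem mem_allowedP_iff (C : Finset (Fin n × Fin n)) (rc : Fin n × Fin n) :
    rc ∈ allowedP n σ I' J' C ↔ ∀ w ∈ C, allowedB n σ I' J' w rc = true := by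
  rw [allowedP, mem_filter]
  exact ⟨fun h w hw => (allowedB_eq_true_iff n σ I' J' w rc).2 (h.2 w hw),
    fun h => ⟨mem_univ _, fun w hw => (allowedB_eq_true_iff n σ I' J' w rc).1 (h w hw)⟩⟩

/-- The rows of `I' ∖ {r}` as an `n`-bit mask (kernel). [folklore] -/
def rowMask (r : Fin n) : ℕ := mkMask (fun i => if h : i < n then decide ((⟨i, h⟩ : Fin n) ∈ I'.erase r) else false) n

/-- Bit `i < n` of `rowMask r`. [folklore] -/
theorem testBit_rowMask (r : Fin n) (i : ℕ) (hi : i < n) :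
    (rowMask n I' r).testBit i = decide ((⟨i, hi⟩ : Fin n) ∈ I'.erase r) := by
  simp only [rowMask, testBit_mkMask, hi, decide_true, Bool.true_and, dif_pos]

/-- The kernel form of the `allowedP` predicate for the witness `w` at the position NUMBER `q`: `q ≠ #w`, and if `rk #w < rk q`
then row `q / n` lies in `I' ∖ {w.1}` (mask `rm`) or column `q % n` in `J' ∖ {w.2}` (mask `cm`). [folklore] -/
def allowedQ (w : Fin n × Fin n) (rm cm : ℕ) (q : ℕ) : Bool :=
  !decide (q = ((vpos n w : Fin (n * n)) : ℕ)) &&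
    (!decide (rk ((vpos n w : Fin (n * n)) : ℕ) < rk q) || rm.testBit (q / n) || cm.testBit (q % n))

/-- The mask of the witness `w` (kernel): bit `q < n²` is set iff the position numbered `q` is allowed for `w`. [folklore] -/
def wmask (w : Fin n × Fin n) : ℕ := mkMask (allowedQ n rk w (rowMask n I' w.1) (rowMask n J' w.2)) (n * n)

variable {σ rk}

/-- Bit `q` of `wmask w`, for `q : Fin (n²)`, is the `allowedP` predicate at the position `vpos⁻¹ q` — provided `rk` is the rank
function of `σ`. [folklore] -/
theorem testBit_wmask (hrk : ∀ q : Fin (n * n), ((σ q : Fin (n * n)) : ℕ) = rk q) (w : Fin n × Fin n) (q : Fin (n * n)) :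
    (wmask n rk I' J' w).testBit q = allowedB n σ I' J' w ((vpos n).symm q) := by
  have hq : (q : ℕ) < n * n := q.2
  have hn : 0 < n := Nat.pos_of_mul_pos_left (lt_of_le_of_lt (Nat.zero_le _) hq)
  have h1 : ((vpos n).symm q).1 = ⟨q / n, Nat.div_lt_of_lt_mul hq⟩ := by
    rw [DetKYLeadingTerms.vpos, finProdFinEquiv_symm_apply]; exact Fin.ext (Fin.coe_divNat q)
  have h2 : ((vpos n).symm q).2 = ⟨q % n, Nat.mod_lt _ hn⟩ := by
    rw [DetKYLeadingTerms.vpos, finProdFinEquiv_symm_apply]; exact Fin.ext (Fin.coe_modNat q)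
  have hlt : (σ (vpos n w) < σ (vpos n ((vpos n).symm q))) ↔ rk (vpos n w : ℕ) < rk q := by
    rw [Equiv.apply_symm_apply, Fin.lt_def, hrk, hrk]
  have hne : ((vpos n).symm q = w) ↔ ((q : ℕ) = (vpos n w : ℕ)) := by
    rw [Equiv.symm_apply_eq]; exact ⟨fun h => by rw [h], fun h => Fin.ext h⟩
  rw [wmask, testBit_mkMask, allowedQ, allowedB, testBit_rowMask n I' w.1 _ (Nat.div_lt_of_lt_mul hq),
    testBit_rowMask n J' w.2 _ (Nat.mod_lt _ hn), ← h1, ← h2]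
  simp only [hq, decide_true, Bool.true_and, decide_eq_decide.mpr hne, decide_eq_decide.mpr hlt]

/-- The cardinality of `allowedP C`, read on the masks: `|allowedP C| = #{q < n² : ∀ w ∈ C, bit q of wmask w}`. [folklore] -/
theorem card_allowedP_eq (hrk : ∀ q : Fin (n * n), ((σ q : Fin (n * n)) : ℕ) = rk q) (C : Finset (Fin n × Fin n)) :
    (allowedP n σ I' J' C).card = capCount (n * n) (wmask n rk I' J') (2 ^ (n * n) - 1) C := by
  rw [capCount, bitSet_full]
  refine card_bij (fun rc _ => ((vpos n rc : Fin (n * n)) : ℕ)) (fun rc hrc => ?_) (fun rc₁ _ rc₂ _ h => ?_) (fun q hq => ?_)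
  · rw [mem_allowedP_iff] at hrc
    simp only [mem_filter, mem_range, Fin.is_lt, true_and]
    intro w hw
    rw [testBit_wmask n I' J' hrk, Equiv.symm_apply_apply]
    exact hrc w hw
  · exact (vpos n).injective (Fin.ext h)
  · simp only [mem_filter, mem_range] at hq
    refine ⟨(vpos n).symm ⟨q, hq.1⟩, ?_, by rw [Equiv.apply_symm_apply]⟩
    rw [mem_allowedP_iff]
    intro w hw
    have h := hq.2 w hw
    rwa [show q = ((⟨q, hq.1⟩ : Fin (n * n)) : ℕ) from rfl, testBit_wmask n I' J' hrk] at h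

end Masks

/-! ## Histograms: per pair `(I', J')`, per row `I'`, total — kernel mirrors on `rk`, meanings on `σ` -/

section Hist

variable (n k : ℕ) (σ : Equiv.Perm (Fin (n * n))) (rk : ℕ → ℕ)

/-- The witness list of `(I', J')`: `I' × J'` in increasing order, built by filtering `List.finRange` (kernel-friendly — no sorting;
duplicate-free, `toFinset = I' ×ˢ J'`). [folklore] -/
def wlist (I' J' : Finset (Fin n)) : List (Fin n × Fin n) :=
  ((List.finRange n).filter (· ∈ I')) ×ˢ ((List.finRange n).filter (· ∈ J'))

/-- `wlist` is duplicate-free. [folklore] -/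
theorem wlist_nodup (I' J' : Finset (Fin n)) : (wlist n I' J').Nodup :=
  ((List.nodup_finRange n).filter _).product ((List.nodup_finRange n).filter _)

/-- `(wlist I' J').toFinset = I' ×ˢ J'`. [folklore] -/
theorem wlist_toFinset (I' J' : Finset (Fin n)) : (wlist n I' J').toFinset = I' ×ˢ J' := by
  ext ⟨r, c⟩
  simp [wlist, List.mem_product, List.mem_filter]

/-- The signed histogram of `a_C` over the nonempty `C ⊆ I' × J'` (KERNEL mirror, on the rank function `rk`). [folklore] -/
def pairHist (I' J' : Finset (Fin n)) : List ℤ :=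
  ieRec (n * n) (wmask n rk I' J') (wlist n I' J') (2 ^ (n * n) - 1) (-1) false

/-- The MATHEMATICAL histogram term of the pair `(I', J')` at `a`: `Σ_{∅≠C⊆I'×J'} (−1)^{|C|+1} [a_C = a]`. [folklore] -/
def histPair (I' J' : Finset (Fin n)) (a : ℕ) : ℤ :=
  ∑ C ∈ (I' ×ˢ J').powerset.filter (·.Nonempty), if (allowedP n σ I' J' C).card = a then (-1 : ℤ) ^ (C.card + 1) else 0

variable {σ rk}

/-- `vget (pairHist I' J') a = histPair I' J' a` (for `rk` the rank function of `σ`). [folklore] -/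
theorem vget_pairHist (hrk : ∀ q : Fin (n * n), ((σ q : Fin (n * n)) : ℕ) = rk q) (I' J' : Finset (Fin n)) (a : ℕ) :
    vget (pairHist n rk I' J') a = histPair n σ I' J' a := by
  rw [pairHist, vget_ieRec _ _ _ (wlist_nodup n I' J'), wlist_toFinset, histPair]
  simp only [Bool.false_eq_true, false_and, if_false, zero_add]
  refine sum_congr rfl fun C _ => ?_
  rw [ieTerm, ← card_allowedP_eq n I' J' hrk, pow_succ]
  split_ifs <;> ring

variable (σ rk)

/-- The `(k+1)`-subsets of `Fin n` as a list of `Finset`s (from `List.sublistsLen`). [folklore] -/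
def subsetsL : List (Finset (Fin n)) := ((List.finRange n).sublistsLen (k + 1)).map List.toFinset

/-- A `Finset` sum over `powersetCard (k+1) univ` is the list sum over `subsetsL`. [folklore] -/
theorem sum_powersetCard_eq_subsetsL {β : Type*} [AddCommMonoid β] (g : Finset (Fin n) → β) :
    ∑ J' ∈ (univ : Finset (Fin n)).powersetCard (k + 1), g J' = ((subsetsL n k).map g).sum := by
  classical
  have hg : g = (g ∘ Multiset.toFinset) ∘ Finset.val := by
    funext J'; simp
  rw [Finset.sum_eq_multiset_sum]
  conv_lhs => rw [hg]
  rw [← Multiset.map_map, Finset.map_val_val_powersetCard, Fin.univ_def]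
  change (Multiset.map (g ∘ Multiset.toFinset) (Multiset.powersetCard (k + 1) (↑(List.finRange n)))).sum = _
  rw [Multiset.powersetCard_coe, Multiset.map_coe, Multiset.sum_coe, subsetsL, List.map_map, List.map_map]
  rfl

/-- The row histogram (KERNEL mirror): `Σ_{J'}` of the pair histograms, as a vector. [folklore] -/
def rowHist (I' : Finset (Fin n)) : List ℤ :=
  (subsetsL n k).foldr (fun J' acc => vadd (pairHist n rk I' J') acc) (vzero (n * n + 1))

/-- The MATHEMATICAL row term at `a`: `Σ_{J'} histPair I' J' a`. [folklore] -/
def histRow (I' : Finset (Fin n)) (a : ℕ) : ℤ :=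
  ∑ J' ∈ (univ : Finset (Fin n)).powersetCard (k + 1), histPair n σ I' J' a

variable {σ rk}

/-- `vget (rowHist I') a = histRow I' a`. [folklore] -/
theorem vget_rowHist (hrk : ∀ q : Fin (n * n), ((σ q : Fin (n * n)) : ℕ) = rk q) (I' : Finset (Fin n)) (a : ℕ) :
    vget (rowHist n k rk I') a = histRow n k σ I' a := by
  rw [rowHist, vget_foldr_vadd, vget_vzero, add_zero, histRow, sum_powersetCard_eq_subsetsL]
  simp only [vget_pairHist n hrk]

variable (σ rk)

/-- The total histogram (KERNEL mirror): `Σ_{I'}` of the row histograms — a `foldr` of `rowHist` over `subsetsL`, which is also the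
form in which per-row kernel literals are assembled when a whole histogram exceeds the per-declaration budget. [folklore] -/
def totHist : List ℤ :=
  (subsetsL n k).foldr (fun I' acc => vadd (rowHist n k rk I') acc) (vzero (n * n + 1))

/-- The MATHEMATICAL histogram `κ_σ(n,k)(a) = Σ_{I',J'} Σ_{∅≠C} (−1)^{|C|+1} [a_C = a]`. [folklore] -/
def histTot (a : ℕ) : ℤ := ∑ I' ∈ (univ : Finset (Fin n)).powersetCard (k + 1), histRow n k σ I' a

variable {σ rk}

/-- `vget totHist a = κ(a)`. [folklore] -/
theorem vget_totHist (hrk : ∀ q : Fin (n * n), ((σ q : Fin (n * n)) : ℕ) = rk q) (a : ℕ) :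
    vget (totHist n k rk) a = histTot n k σ a := by
  rw [totHist, vget_foldr_vadd, vget_vzero, add_zero, histTot, sum_powersetCard_eq_subsetsL]
  simp only [vget_rowHist n k hrk]

variable (σ)

/-! ## The exchange of summation: `lt2IEFast = Σ_a κ(a) · C(a, n²−1−p)` -/

/-- The binomial factor of `lt2IEFast` at histogram index `a` (`descFactorial / factorial`, as there). [folklore] -/
def binFac (a p : ℕ) : ℤ := ((a.descFactorial (n * n - (p + 1)) / (n * n - (p + 1)).factorial : ℕ) : ℤ)

/-- One term of `lt2IEFast` spread over the histogram indices `a ≤ n²`. [folklore] -/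
theorem term_eq_sum_ite (p : ℕ) (I' J' : Finset (Fin n)) (C : Finset (Fin n × Fin n)) :
    (-1 : ℤ) ^ (C.card + 1) * binFac n (allowedP n σ I' J' C).card p =
      ∑ a ∈ range (n * n + 1), (if (allowedP n σ I' J' C).card = a then (-1 : ℤ) ^ (C.card + 1) else 0) * binFac n a p := by
  have hmem : (allowedP n σ I' J' C).card ∈ range (n * n + 1) := by
    rw [mem_range, Nat.lt_succ_iff]
    calc (allowedP n σ I' J' C).card ≤ (univ : Finset (Fin n × Fin n)).card := card_le_card (subset_univ _)
      _ = n * n := by rw [card_univ, Fintype.card_prod, Fintype.card_fin]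
  simp_rw [ite_mul, zero_mul]
  rw [sum_ite_eq (range (n * n + 1)) ((allowedP n σ I' J' C).card) (fun a => (-1 : ℤ) ^ (C.card + 1) * binFac n a p), if_pos hmem]

/-- **Histogram form of the fast evaluation**: `lt2IEFast n p k σ = Σ_{a ≤ n²} κ_σ(n,k)(a) · C(a, n²−1−p)`. [folklore] -/
theorem lt2IEFast_eq_sum_histTot (p : ℕ) :
    lt2IEFast n p k σ = ∑ a ∈ range (n * n + 1), histTot n k σ a * binFac n a p := by
  unfold lt2IEFast
  simp_rw [show ∀ (I' J' : Finset (Fin n)) (C : Finset (Fin n × Fin n)),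
      (-1 : ℤ) ^ (C.card + 1) * (((allowedP n σ I' J' C).card.descFactorial (n * n - (p + 1)) / (n * n - (p + 1)).factorial : ℕ) : ℤ)
        = (-1 : ℤ) ^ (C.card + 1) * binFac n (allowedP n σ I' J' C).card p from fun _ _ _ => rfl,
    term_eq_sum_ite]
  symm
  simp_rw [histTot, histRow, histPair, sum_mul]
  rw [sum_comm]
  refine sum_congr rfl fun I' _ => ?_
  rw [sum_comm]
  refine sum_congr rfl fun J' _ => ?_
  rw [sum_comm]

variable {σ}

/-- The same with the kernel mirror: `lt2IEFast n p k σ = Σ_{a ≤ n²} vget (totHist n k rk) a · C(a, n²−1−p)`. [folklore] -/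
theorem lt2IEFast_eq_histSum (hrk : ∀ q : Fin (n * n), ((σ q : Fin (n * n)) : ℕ) = rk q) (p : ℕ) :
    lt2IEFast n p k σ = ∑ a ∈ range (n * n + 1), vget (totHist n k rk) a * binFac n a p := by
  rw [lt2IEFast_eq_sum_histTot]
  simp only [vget_totHist n k hrk]

/-- **Certificate interface on histograms**: if `rk` is the rank function of `σ`, `H` is the kernel value of `totHist n k rk` and
`b ≤ Σ_{a ≤ n²} H[a] · C(a, n²−1−p)`, then `b ≤ rank KY_{p,k}(det_n)` (`p + 1 ≤ n²`, any field). [folklore] -/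
theorem le_kyRank_detPoly_of_hist (K : Type*) [Field K] (hrk : ∀ q : Fin (n * n), ((σ q : Fin (n * n)) : ℕ) = rk q)
    {p : ℕ} (hp : p + 1 ≤ n * n) (H : List ℤ) (hH : totHist n k rk = H) (b : ℕ)
    (hb : (b : ℤ) ≤ ∑ a ∈ range (n * n + 1), vget H a * binFac n a p) :
    b ≤ kyRank K p k (detPoly (Fin n) K) := by
  rw [← hH, ← lt2IEFast_eq_histSum n k hrk] at hb
  exact le_kyRank_detPoly_of_le_lt2IEFast K hp b hb

end Hist

/-! ### Kernel sanity (`det₃`, `k = 1`, row-major): the histogram has `10` entries and reproduces `LT2₁(3,4,1) = 726`. -/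

example : totHist 3 1 id = [-4, 9, 2, -11, 1, -3, 5, 1, 9, 0] := by decide +kernel

example : (∑ a ∈ range (3 * 3 + 1), vget [-4, 9, 2, -11, 1, -3, 5, 1, 9, 0] a * binFac 3 a 4) = 726 := by decide +kernel

end DetKYLeadingTermsTwo

/-! ## The packaged statement of this module (PROVED) -/

/-- `GCT/Max` support **LT2HistogramCertificate** — the certificate interface on the HISTOGRAM mirror: for all `n k p b σ rk H`
with `p + 1 ≤ n²` and `rk` the rank function of `σ` (`∀ q, (σ q : ℕ) = rk q`): if `totHist n k rk = H` (a kernel equation) and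
`b ≤ Σ_{a ≤ n²} H[a]·C(a, n²−1−p)` then `b ≤ rank KY_{p,k}(det_n)` over `ℂ`.  A statement of the cell, PROVED below
(`lt2IEFast = Σ_a κ(a)·C(a,·)` and `H = κ`). [folklore] -/
def LT2HistogramCertificate : Prop :=
  ∀ (n k p b : ℕ) (σ : Equiv.Perm (Fin (n * n))) (rk : ℕ → ℕ) (H : List ℤ), p + 1 ≤ n * n →
    (∀ q : Fin (n * n), ((σ q : Fin (n * n)) : ℕ) = rk q) → DetKYLeadingTermsTwo.totHist n k rk = H →
      (b : ℤ) ≤ ∑ a ∈ Finset.range (n * n + 1), DetKYLeadingTermsTwo.vget H a * DetKYLeadingTermsTwo.binFac n a p →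
        b ≤ kyRank ℂ p k (detPoly (Fin n) ℂ)

/-- `LT2HistogramCertificate` holds. [folklore] -/
theorem lt2HistogramCertificate_holds : LT2HistogramCertificate :=
  fun n k _ b _ _ H hp hrk hH hb => DetKYLeadingTermsTwo.le_kyRank_detPoly_of_hist n k ℂ hrk hp H hH b hb

end Summit.PneNP.GCT
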